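/-
Copyright: lit-balaban cell (HOME `run/shared/lean/pub/lit-balaban/`), Phase-2 proof seat p12 (gen 7).  The proofs reproduce the
printed arguments; nothing is claimed beyond what the kernel checks below.
-/
import Literature.MathematicalPhysics.QuantumFieldTheory.DybalskiStottmeisterTanimoto2024.DST24RemainderBounds
import Literature.MathematicalPhysics.QuantumFieldTheory.DybalskiStottmeisterTanimoto2024.DST24RstarBounds

/-!
# `DybalskiStottmeisterTanimoto2024.DST24RemainderLipschitz` — [DybalskiStottmeisterTanimoto2024] **§4.1 (bracket-relation) and
# §4.6 Lemma (r-lemma-two)** PROVED: the map `[A⃗] = U′` (`δ = 1`), and the Lipschitz bound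
# `‖∂*r⃗_{A⃗₁} − ∂*r⃗_{A⃗₂}‖_{∞;Ω} ≤ 96(ε + ε₁)‖A⃗₁ − A⃗₂‖_{∞;Ω}`

statement-level skeleton of published theorems with citation tags; proofs where landed; nothing here is a claim about
the Yang–Mills mass gap

W. Dybalski, A. Stottmeister, Y. Tanimoto, *The Bałaban variational problem in the non-linear sigma model*, Rev. Math. Phys.
**36** (2024), arXiv:2403.09800; source held `paper:arxiv-2403.09800` (§4.1 (bracket-relation) = tex chunk p0011; §4.6 Lemma
(r-lemma-two) = p0017–p0018).  Unit `lit-balaban-p12` (gen 7); (terms) = `rvec_formula` (`DST24RemainderFormula`, corrected signs —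
irrelevant here, the bounds are term-wise), (first/second-delta-estimate) from `DST24RemainderBounds`/`DST24RstarBounds`.

WHAT IS PRINTED AND PROVED HERE.
* §4.1 (bracket-relation) «the relation (Pauli-matrices-decomposition) is invertible in this case, if we specify to `δ = 1` … we can
  define the map `[A⃗(x)] = U′(x)` … the inverse is simple: `½Tr(U′(x)σ⃗) = A⃗(x)`» — `brk` (`[A⃗] = A₀ − A⃗` as a unit quaternion,
  `A₀ = √(1 − |A⃗|²)`), `brk_val`, `re_brk`, `vecOf_brk` (`A⃗([A⃗]) = A⃗`), `brk_vecOf` (`[A⃗(U′)] = U′` for `Re U′ ≥ 0`), `brkConf`.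
* §4.6 Lemma (r-lemma-two) «Suppose that `|V⃗(b)| ≤ ε₁`, `A⃗₁, A⃗₂ ∈ Conf⃗^ε(Ω)`, `s₁ = s₂ = 1`, `0 < ε₁, ε ≤ 1/2`.  Then
  `‖∂*r⃗_{A⃗₁} − ∂*r⃗_{A⃗₂}‖_{∞;Ω} ≤ 96(ε + ε₁)‖A⃗₁ − A⃗₂‖_{∞;Ω}`» — `norm_rvec_sub_le` (per bond, `≤ 24(ε+ε₁)‖A⃗₁ − A⃗₂‖_∞`, from
  term-wise Lipschitz bounds of the nine terms of (terms): «Contributions `r⃗₁, r⃗₂` … `4(3ε² + ε₁²)`», «`r⃗₃`», …) and `r_lemma_two`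
  (the factor `4` of (lap-2)).  Our per-term constants add up to `5ε + 9ε₁ ≤ 24(ε + ε₁)` per bond; the printed `96(ε+ε₁)` follows.
-/

namespace Literature.MathematicalPhysics.QuantumFieldTheory.DybalskiStottmeisterTanimoto2024.DST24RemainderLipschitz

open scoped Quaternion RealInnerProductSpace BigOperators
open Literature.MathematicalPhysics.QuantumFieldTheory.Federbush1986
open Literature.MathematicalPhysics.QuantumFieldTheory.DybalskiStottmeisterTanimoto2024.DST24Setting
open Literature.MathematicalPhysics.QuantumFieldTheory.DybalskiStottmeisterTanimoto2024.DST24Configurations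
open Literature.MathematicalPhysics.QuantumFieldTheory.DybalskiStottmeisterTanimoto2024.DST24TangentSpace
open Literature.MathematicalPhysics.QuantumFieldTheory.DybalskiStottmeisterTanimoto2024.DST24CriticalPoint
open Literature.MathematicalPhysics.QuantumFieldTheory.DybalskiStottmeisterTanimoto2024.DST24RemainderFormula
open Literature.MathematicalPhysics.QuantumFieldTheory.DybalskiStottmeisterTanimoto2024.DST24RemainderBounds
open Literature.MathematicalPhysics.QuantumFieldTheory.DybalskiStottmeisterTanimoto2024.DST24RstarBounds hiding norm_crossLin_le

noncomputable section

variable {L n₁ : ℕ}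

/-! ## §4.1 (bracket-relation): `[A⃗] = U′` -/

/-- `‖A₀ − A⃗‖ = 1` for `|A⃗| ≤ 1` (`A₀² + |A⃗|² = 1`). [cite: DybalskiStottmeisterTanimoto2024, §4.1 (bracket-relation)] -/
theorem norm_A0_sub_eq_one (A : su2) (h : ‖A‖ ≤ 1) : ‖((A0 A : ℝ) : ℍ) - (A : ℍ)‖ = 1 := by
  have hA := su2.re_coe A
  have hsq : A0 A ^ 2 = 1 - ‖A‖ ^ 2 := Real.sq_sqrt (by nlinarith [norm_nonneg A])
  have hn : ‖((A0 A : ℝ) : ℍ) - (A : ℍ)‖ ^ 2 = 1 := by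
    rw [sq, ← Quaternion.normSq_eq_norm_mul_self, Quaternion.normSq_def', norm_sq_su2] at *
    simp only [Quaternion.re_sub, Quaternion.imI_sub, Quaternion.imJ_sub, Quaternion.imK_sub, Quaternion.re_coe,
      Quaternion.imI_coe, Quaternion.imJ_coe, Quaternion.imK_coe, hA]
    nlinarith [hsq]
  have h0 := norm_nonneg (((A0 A : ℝ) : ℍ) - (A : ℍ))
  nlinarith

/-- (bracket-relation) `[A⃗] := A₀ + iA⃗·σ⃗ ∈ SU(2)` with `δ = 1`, i.e. the unit quaternion `A₀ − A⃗` (`vecOf = −Im`); set to `1`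
off the unit ball (never used there). [cite: DybalskiStottmeisterTanimoto2024, §4.1 (bracket-relation) («`[A⃗(x)] = U′(x)`»)] -/
def brk (A : su2) : SU2 :=
  open Classical in
  if h : ‖A‖ ≤ 1 then ⟨((A0 A : ℝ) : ℍ) - (A : ℍ), norm_A0_sub_eq_one A h⟩ else 1

/-- `[A⃗] = A₀ − A⃗` as a quaternion. [cite: DybalskiStottmeisterTanimoto2024, §4.1 (bracket-relation)] -/
theorem brk_val (A : su2) (h : ‖A‖ ≤ 1) : (brk A).val = ((A0 A : ℝ) : ℍ) - (A : ℍ) := by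
  rw [brk, dif_pos h]

/-- `Re[A⃗] = A₀` (`δ = 1`). [cite: DybalskiStottmeisterTanimoto2024, §4.1 (bracket-relation) («if we specify to `δ = 1`»)] -/
theorem re_brk (A : su2) (h : ‖A‖ ≤ 1) : (brk A).val.re = A0 A := by
  rw [brk_val A h, Quaternion.re_sub, Quaternion.re_coe, su2.re_coe A, sub_zero]

/-- «the inverse is simple: `½Tr(U′(x)σ⃗) = A⃗(x)`»: `A⃗([A⃗]) = A⃗`. [cite: DybalskiStottmeisterTanimoto2024, §4.1 (bracket-relation)] -/
theorem vecOf_brk (A : su2) (h : ‖A‖ ≤ 1) : vecOf (brk A).val = A := by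
  apply Subtype.ext
  rw [vecOf_coe, brk_val A h, Quaternion.im_sub, Quaternion.im_coe, zero_sub, neg_neg, su2.im_coe]

/-- `[A⃗(U′)] = U′` for `Re U′ ≥ 0` («the relation (Pauli-matrices-decomposition) is invertible … if we specify to `δ = 1`»).
[cite: DybalskiStottmeisterTanimoto2024, §4.1 (bracket-relation)] -/
theorem brk_vecOf (q : SU2) (hq : 0 ≤ q.val.re) : brk (vecOf q.val) = q := by
  apply SU2.ext
  rw [brk_val _ (norm_vecOf_le_one q), A0_vecOf_eq_re q hq, vecOf_coe, sub_neg_eq_add, Quaternion.re_add_im]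

/-- The configuration `U′ = [A⃗]` of a vector field. [cite: DybalskiStottmeisterTanimoto2024, §4.1 («This provides us with `U = U′V ∈ Conf(Ω)`»)] -/
def brkConf (A : Site L n₁ → su2) : Conf L n₁ := fun x => brk (A x)

/-- `A⃗(U′) = A⃗` for `U′ = [A⃗]`. [cite: DybalskiStottmeisterTanimoto2024, §4.1 (bracket-relation)] -/
theorem Avec_brkConf (A : Site L n₁ → su2) (hA : ∀ x, ‖A x‖ ≤ 1) (x : Site L n₁) : Avec (brkConf A) x = A x :=
  vecOf_brk (A x) (hA x)

/-! ## Term-wise Lipschitz bounds -/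

section Lip

variable {E : Type*} [SeminormedAddCommGroup E] [NormedSpace ℝ E]

/-- `‖a₁X₁ − a₂X₂‖ ≤ |a₁ − a₂|‖X₁‖ + |a₂|‖X₁ − X₂‖`. [cite: DybalskiStottmeisterTanimoto2024, §4.6 proof of Lemma (r-lemma-two) («We consider the difference»)] -/
theorem norm_smul_sub_smul_le (a₁ a₂ : ℝ) (X₁ X₂ : E) :
    ‖a₁ • X₁ - a₂ • X₂‖ ≤ |a₁ - a₂| * ‖X₁‖ + |a₂| * ‖X₁ - X₂‖ := by
  have e : a₁ • X₁ - a₂ • X₂ = (a₁ - a₂) • X₁ + a₂ • (X₁ - X₂) := by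
    rw [sub_smul, smul_sub]; abel
  rw [e]
  refine (norm_add_le _ _).trans ?_
  rw [norm_smul, norm_smul, Real.norm_eq_abs, Real.norm_eq_abs]

end Lip

/-- `[A⃗×]` is linear in `A⃗`: `(P₁ − P₂) × Q = P₁ × Q − P₂ × Q`. [cite: DybalskiStottmeisterTanimoto2024, §3.2 (def-R)] -/
theorem crossLin_sub_left (P₁ P₂ Q : su2) : crossLin (P₁ - P₂) Q = crossLin P₁ Q - crossLin P₂ Q := by
  apply Subtype.ext
  simp only [crossLin_coe, Submodule.coe_sub, sub_mul, Quaternion.im_sub]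

/-- `‖P₁×Q₁ − P₂×Q₂‖ ≤ ‖P₁ − P₂‖‖Q₁‖ + ‖P₂‖‖Q₁ − Q₂‖`. [cite: DybalskiStottmeisterTanimoto2024, §4.6 proof of Lemma (r-lemma-two) (contributions `r⃗₄, r⃗₅, r⃗₆`)] -/
theorem norm_crossLin_sub_le (P₁ P₂ Q₁ Q₂ : su2) :
    ‖crossLin P₁ Q₁ - crossLin P₂ Q₂‖ ≤ ‖P₁ - P₂‖ * ‖Q₁‖ + ‖P₂‖ * ‖Q₁ - Q₂‖ := by
  have e : crossLin P₁ Q₁ - crossLin P₂ Q₂ = crossLin (P₁ - P₂) Q₁ + crossLin P₂ (Q₁ - Q₂) := by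
    rw [crossLin_sub_left, map_sub]; abel
  rw [e]
  exact (norm_add_le _ _).trans (add_le_add (norm_crossLin_le _ _) (norm_crossLin_le _ _))

/-- `|⟨P₁,Q₁⟩ − ⟨P₂,Q₂⟩| ≤ ‖P₁ − P₂‖‖Q₁‖ + ‖P₂‖‖Q₁ − Q₂‖`. [cite: DybalskiStottmeisterTanimoto2024, §4.6 proof of Lemma (r-lemma-two) (contributions `r⃗₇, r⃗₈, r⃗₉`)] -/
theorem abs_inner_sub_inner_le (P₁ P₂ Q₁ Q₂ : su2) :
    |⟪P₁, Q₁⟫ - ⟪P₂, Q₂⟫| ≤ ‖P₁ - P₂‖ * ‖Q₁‖ + ‖P₂‖ * ‖Q₁ - Q₂‖ := by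
  have e : ⟪P₁, Q₁⟫ - ⟪P₂, Q₂⟫ = ⟪P₁ - P₂, Q₁⟫ + ⟪P₂, Q₁ - Q₂⟫ := by
    rw [inner_sub_left, inner_sub_right]; ring
  rw [e]
  exact (abs_add_le _ _).trans (add_le_add (abs_real_inner_le_norm _ _) (abs_real_inner_le_norm _ _))

/-- The nine-term expression of (terms) as a function of the data at one bond: `(U⃗, Z⃗, U⁰, Z⁰)` with `V⃗, V⁰` fixed.
[cite: DybalskiStottmeisterTanimoto2024, §3.4 (terms); §4.6 (terms-one)] -/
def nineTerms (V : su2) (v0 : ℝ) (U Z : su2) (u0 z0 : ℝ) : su2 :=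
  (1 - u0 * v0) • Z - (1 - z0 * v0) • U + (z0 * u0) • V - z0 • crossLin U V + u0 • crossLin V Z + v0 • crossLin U Z
    + ⟪U, V⟫ • Z + ⟪Z, V⟫ • U - ⟪Z, U⟫ • V

/-- `r⃗(b)` for `U′ = [A⃗]` is the nine-term expression in `A⃗(b₋), A⃗(b₊), A₀(b₋), A₀(b₊)`.
[cite: DybalskiStottmeisterTanimoto2024, §4.6 (terms-one)] -/
theorem rvec_brkConf (A : Site L n₁ → su2) (hA : ∀ x, ‖A x‖ ≤ 1) (V : CConf n₁) (b : Bond L n₁) :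
    rvec (brkConf A) V b = nineTerms (vecOf (pdV V b)) (pdV V b).re (A b.src) (A b.tgt) (A0 (A b.src)) (A0 (A b.tgt)) := by
  rw [rvec_formula, nineTerms, Avec_brkConf A hA, Avec_brkConf A hA]
  simp only [brkConf, re_brk _ (hA _)]

section TermBounds

variable {ε ε₁ Δ : ℝ}

/-- Terms `r⃗₁, r⃗₂` of (terms-one): `‖δ(u₁V⁰)Z⃗₁ − δ(u₂V⁰)Z⃗₂‖ ≤ (3ε² + ε₁²)Δ` («Contributions `r⃗₁, r⃗₂` … `4(3ε² + ε₁²)`» before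
the factor `4` of (lap-2)). [cite: DybalskiStottmeisterTanimoto2024, §4.6 proof of Lemma (r-lemma-two), item `r⃗₁, r⃗₂`] -/
theorem lip_term1 (hε : 0 ≤ ε) (hΔ : 0 ≤ Δ) {Z₁ Z₂ : su2} {v0 u₁ u₂ : ℝ} (hv0 : 0 ≤ v0) (hv1 : v0 ≤ 1)
    (hZ₁ : ‖Z₁‖ ≤ ε) (hdu : |u₁ - u₂| ≤ 2 * ε * Δ) (hδ0 : 0 ≤ 1 - u₂ * v0) (hδu : 1 - u₂ * v0 ≤ ε ^ 2 + ε₁ ^ 2)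
    (hΔZ : ‖Z₁ - Z₂‖ ≤ Δ) : ‖(1 - u₁ * v0) • Z₁ - (1 - u₂ * v0) • Z₂‖ ≤ (3 * ε ^ 2 + ε₁ ^ 2) * Δ := by
  refine (norm_smul_sub_smul_le _ _ _ _).trans ?_
  have e1 : |(1 - u₁ * v0) - (1 - u₂ * v0)| = |u₁ - u₂| * v0 := by
    rw [show (1 - u₁ * v0) - (1 - u₂ * v0) = -((u₁ - u₂) * v0) by ring, abs_neg, abs_mul, abs_of_nonneg hv0]
  rw [e1, abs_of_nonneg hδ0]
  have ha : |u₁ - u₂| * v0 ≤ 2 * ε * Δ := by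
    calc |u₁ - u₂| * v0 ≤ (2 * ε * Δ) * 1 := mul_le_mul hdu hv1 hv0 (by positivity)
      _ = 2 * ε * Δ := mul_one _
  have hb : |u₁ - u₂| * v0 * ‖Z₁‖ ≤ (2 * ε * Δ) * ε := mul_le_mul ha hZ₁ (norm_nonneg _) (by positivity)
  have hc : (1 - u₂ * v0) * ‖Z₁ - Z₂‖ ≤ (ε ^ 2 + ε₁ ^ 2) * Δ := mul_le_mul hδu hΔZ (norm_nonneg _) (by positivity)
  linarith only [hb, hc]

/-- Term `r⃗₃`: `‖Z⁰₁U⁰₁V⃗ − Z⁰₂U⁰₂V⃗‖ ≤ 4εε₁Δ`. [cite: DybalskiStottmeisterTanimoto2024, §4.6 proof of Lemma (r-lemma-two), item `r⃗₃`] -/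
theorem lip_term3 (hε : 0 ≤ ε) (hΔ : 0 ≤ Δ) {V : su2} {u₁ u₂ z₁ z₂ : ℝ} (hV : ‖V‖ ≤ ε₁)
    (hu₁ : 0 ≤ u₁) (hu₁' : u₁ ≤ 1) (hz₂ : 0 ≤ z₂) (hz₂' : z₂ ≤ 1)
    (hdu : |u₁ - u₂| ≤ 2 * ε * Δ) (hdz : |z₁ - z₂| ≤ 2 * ε * Δ) :
    ‖(z₁ * u₁) • V - (z₂ * u₂) • V‖ ≤ 4 * ε * ε₁ * Δ := by
  refine (norm_smul_sub_smul_le _ _ _ _).trans ?_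
  rw [sub_self, norm_zero, mul_zero, add_zero]
  have h1 : |z₁ * u₁ - z₂ * u₂| ≤ 4 * ε * Δ := by
    rw [show z₁ * u₁ - z₂ * u₂ = (z₁ - z₂) * u₁ + z₂ * (u₁ - u₂) by ring]
    refine (abs_add_le _ _).trans ?_
    rw [abs_mul, abs_mul, abs_of_nonneg hu₁, abs_of_nonneg hz₂]
    have ha : |z₁ - z₂| * u₁ ≤ (2 * ε * Δ) * 1 := mul_le_mul hdz hu₁' hu₁ (by positivity)
    have hb : z₂ * |u₁ - u₂| ≤ 1 * (2 * ε * Δ) := mul_le_mul hz₂' hdu (abs_nonneg _) zero_le_one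
    linarith only [ha, hb]
  calc |z₁ * u₁ - z₂ * u₂| * ‖V‖ ≤ (4 * ε * Δ) * ε₁ := mul_le_mul h1 hV (norm_nonneg _) (by positivity)
    _ = 4 * ε * ε₁ * Δ := by ring

/-- Term `r⃗₄`: `‖Z⁰₁(U⃗₁×V⃗) − Z⁰₂(U⃗₂×V⃗)‖ ≤ (2ε²ε₁ + ε₁)Δ`. [cite: DybalskiStottmeisterTanimoto2024, §4.6 proof of Lemma (r-lemma-two), items `r⃗₄, r⃗₅`] -/
theorem lip_term4 (hε : 0 ≤ ε) (hΔ : 0 ≤ Δ) {V U₁ U₂ : su2} {z₁ z₂ : ℝ} (hV : ‖V‖ ≤ ε₁) (hU₁ : ‖U₁‖ ≤ ε)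
    (hz₂ : 0 ≤ z₂) (hz₂' : z₂ ≤ 1) (hdz : |z₁ - z₂| ≤ 2 * ε * Δ) (hΔU : ‖U₁ - U₂‖ ≤ Δ) :
    ‖z₁ • crossLin U₁ V - z₂ • crossLin U₂ V‖ ≤ (2 * ε ^ 2 * ε₁ + ε₁) * Δ := by
  have hε₁ : 0 ≤ ε₁ := (norm_nonneg _).trans hV
  refine (norm_smul_sub_smul_le _ _ _ _).trans ?_
  have h1 : ‖crossLin U₁ V‖ ≤ ε * ε₁ := (norm_crossLin_le _ _).trans (mul_le_mul hU₁ hV (norm_nonneg _) hε)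
  have h2 : ‖crossLin U₁ V - crossLin U₂ V‖ ≤ Δ * ε₁ := by
    rw [← crossLin_sub_left]; exact (norm_crossLin_le _ _).trans (mul_le_mul hΔU hV (norm_nonneg _) hΔ)
  have ha : |z₁ - z₂| * ‖crossLin U₁ V‖ ≤ (2 * ε * Δ) * (ε * ε₁) := mul_le_mul hdz h1 (norm_nonneg _) (by positivity)
  have hb : |z₂| * ‖crossLin U₁ V - crossLin U₂ V‖ ≤ 1 * (Δ * ε₁) :=
    mul_le_mul (by rw [abs_of_nonneg hz₂]; exact hz₂') h2 (norm_nonneg _) zero_le_one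
  linarith only [ha, hb]

/-- Term `r⃗₅`: `‖U⁰₁(V⃗×Z⃗₁) − U⁰₂(V⃗×Z⃗₂)‖ ≤ (2ε²ε₁ + ε₁)Δ`. [cite: DybalskiStottmeisterTanimoto2024, §4.6 proof of Lemma (r-lemma-two), items `r⃗₄, r⃗₅`] -/
theorem lip_term5 (hε : 0 ≤ ε) (hΔ : 0 ≤ Δ) {V Z₁ Z₂ : su2} {u₁ u₂ : ℝ} (hV : ‖V‖ ≤ ε₁) (hZ₁ : ‖Z₁‖ ≤ ε)
    (hu₂ : 0 ≤ u₂) (hu₂' : u₂ ≤ 1) (hdu : |u₁ - u₂| ≤ 2 * ε * Δ) (hΔZ : ‖Z₁ - Z₂‖ ≤ Δ) :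
    ‖u₁ • crossLin V Z₁ - u₂ • crossLin V Z₂‖ ≤ (2 * ε ^ 2 * ε₁ + ε₁) * Δ := by
  have hε₁ : 0 ≤ ε₁ := (norm_nonneg _).trans hV
  refine (norm_smul_sub_smul_le _ _ _ _).trans ?_
  have h1 : ‖crossLin V Z₁‖ ≤ ε₁ * ε := (norm_crossLin_le _ _).trans (mul_le_mul hV hZ₁ (norm_nonneg _) hε₁)
  have h2 : ‖crossLin V Z₁ - crossLin V Z₂‖ ≤ ε₁ * Δ := by
    rw [← map_sub]; exact (norm_crossLin_le _ _).trans (mul_le_mul hV hΔZ (norm_nonneg _) hε₁)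
  have ha : |u₁ - u₂| * ‖crossLin V Z₁‖ ≤ (2 * ε * Δ) * (ε₁ * ε) := mul_le_mul hdu h1 (norm_nonneg _) (by positivity)
  have hb : |u₂| * ‖crossLin V Z₁ - crossLin V Z₂‖ ≤ 1 * (ε₁ * Δ) :=
    mul_le_mul (by rw [abs_of_nonneg hu₂]; exact hu₂') h2 (norm_nonneg _) zero_le_one
  linarith only [ha, hb]

/-- Term `r⃗₆`: `‖V⁰(U⃗₁×Z⃗₁) − V⁰(U⃗₂×Z⃗₂)‖ ≤ 2εΔ`. [cite: DybalskiStottmeisterTanimoto2024, §4.6 proof of Lemma (r-lemma-two), item `r⃗₆`] -/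
theorem lip_term6 (hε : 0 ≤ ε) (hΔ : 0 ≤ Δ) {U₁ U₂ Z₁ Z₂ : su2} {v0 : ℝ} (hv0 : 0 ≤ v0) (hv1 : v0 ≤ 1)
    (hZ₁ : ‖Z₁‖ ≤ ε) (hU₂ : ‖U₂‖ ≤ ε) (hΔU : ‖U₁ - U₂‖ ≤ Δ) (hΔZ : ‖Z₁ - Z₂‖ ≤ Δ) :
    ‖v0 • crossLin U₁ Z₁ - v0 • crossLin U₂ Z₂‖ ≤ 2 * ε * Δ := by
  refine (norm_smul_sub_smul_le _ _ _ _).trans ?_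
  rw [sub_self, abs_zero, zero_mul, zero_add, abs_of_nonneg hv0]
  have h := (norm_crossLin_sub_le U₁ U₂ Z₁ Z₂).trans
    (add_le_add (mul_le_mul hΔU hZ₁ (norm_nonneg _) hΔ) (mul_le_mul hU₂ hΔZ (norm_nonneg _) hε))
  have hb : v0 * ‖crossLin U₁ Z₁ - crossLin U₂ Z₂‖ ≤ 1 * (Δ * ε + ε * Δ) := mul_le_mul hv1 h (norm_nonneg _) zero_le_one
  linarith only [hb]

/-- Terms `r⃗₇, r⃗₈`: `‖(U⃗₁·V⃗)Z⃗₁ − (U⃗₂·V⃗)Z⃗₂‖ ≤ 2εε₁Δ`. [cite: DybalskiStottmeisterTanimoto2024, §4.6 proof of Lemma (r-lemma-two), items `r⃗₇, r⃗₈, r⃗₉`] -/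
theorem lip_term7 (hε : 0 ≤ ε) (hΔ : 0 ≤ Δ) {V U₁ U₂ Z₁ Z₂ : su2} (hV : ‖V‖ ≤ ε₁) (hU₂ : ‖U₂‖ ≤ ε) (hZ₁ : ‖Z₁‖ ≤ ε)
    (hΔU : ‖U₁ - U₂‖ ≤ Δ) (hΔZ : ‖Z₁ - Z₂‖ ≤ Δ) : ‖⟪U₁, V⟫ • Z₁ - ⟪U₂, V⟫ • Z₂‖ ≤ 2 * ε * ε₁ * Δ := by
  have hε₁ : 0 ≤ ε₁ := (norm_nonneg _).trans hV
  refine (norm_smul_sub_smul_le _ _ _ _).trans ?_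
  have h1 : |⟪U₁, V⟫ - ⟪U₂, V⟫| ≤ Δ * ε₁ := by
    have := abs_inner_sub_inner_le U₁ U₂ V V
    rw [sub_self, norm_zero, mul_zero, add_zero] at this
    exact this.trans (mul_le_mul hΔU hV (norm_nonneg _) hΔ)
  have h2 : |⟪U₂, V⟫| ≤ ε * ε₁ := (abs_real_inner_le_norm _ _).trans (mul_le_mul hU₂ hV (norm_nonneg _) hε)
  have ha : |⟪U₁, V⟫ - ⟪U₂, V⟫| * ‖Z₁‖ ≤ (Δ * ε₁) * ε := mul_le_mul h1 hZ₁ (norm_nonneg _) (by positivity)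
  have hb : |⟪U₂, V⟫| * ‖Z₁ - Z₂‖ ≤ (ε * ε₁) * Δ := mul_le_mul h2 hΔZ (norm_nonneg _) (by positivity)
  linarith only [ha, hb]

/-- Term `r⃗₉`: `‖(Z⃗₁·U⃗₁)V⃗ − (Z⃗₂·U⃗₂)V⃗‖ ≤ 2εε₁Δ`. [cite: DybalskiStottmeisterTanimoto2024, §4.6 proof of Lemma (r-lemma-two), items `r⃗₇, r⃗₈, r⃗₉`] -/
theorem lip_term9 (hε : 0 ≤ ε) (hΔ : 0 ≤ Δ) {V U₁ U₂ Z₁ Z₂ : su2} (hV : ‖V‖ ≤ ε₁) (hU₁ : ‖U₁‖ ≤ ε) (hZ₂ : ‖Z₂‖ ≤ ε)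
    (hΔU : ‖U₁ - U₂‖ ≤ Δ) (hΔZ : ‖Z₁ - Z₂‖ ≤ Δ) : ‖⟪Z₁, U₁⟫ • V - ⟪Z₂, U₂⟫ • V‖ ≤ 2 * ε * ε₁ * Δ := by
  have hε₁ : 0 ≤ ε₁ := (norm_nonneg _).trans hV
  refine (norm_smul_sub_smul_le _ _ _ _).trans ?_
  rw [sub_self, norm_zero, mul_zero, add_zero]
  have h1 : |⟪Z₁, U₁⟫ - ⟪Z₂, U₂⟫| ≤ Δ * ε + ε * Δ :=
    (abs_inner_sub_inner_le Z₁ Z₂ U₁ U₂).trans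
      (add_le_add (mul_le_mul hΔZ hU₁ (norm_nonneg _) hΔ) (mul_le_mul hZ₂ hΔU (norm_nonneg _) hε))
  calc |⟪Z₁, U₁⟫ - ⟪Z₂, U₂⟫| * ‖V‖ ≤ (Δ * ε + ε * Δ) * ε₁ := mul_le_mul h1 hV (norm_nonneg _) (by positivity)
    _ = 2 * ε * ε₁ * Δ := by ring

/-- The constants add up: `2(3ε²+ε₁²) + 4εε₁ + 2(2ε²ε₁+ε₁) + 2ε + 6εε₁ ≤ 24(ε+ε₁)` for `0 ≤ ε, ε₁ ≤ 1/2` (the print's tally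
«`≤ 24(ε₁+ε₁+ε₁+ε+ε²+ε₁²) ≤ 24·4(ε₁+ε)`» before the factor of (lap-2), with our constants).
[cite: DybalskiStottmeisterTanimoto2024, §4.6 proof of Lemma (r-lemma-two), final tally] -/
theorem lip_tally (hε : 0 ≤ ε) (hε' : ε ≤ 1 / 2) (hε₁ : 0 ≤ ε₁) (hε₁' : ε₁ ≤ 1 / 2) (hΔ : 0 ≤ Δ) :
    (3 * ε ^ 2 + ε₁ ^ 2) * Δ + (3 * ε ^ 2 + ε₁ ^ 2) * Δ + 4 * ε * ε₁ * Δ + (2 * ε ^ 2 * ε₁ + ε₁) * Δ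
      + (2 * ε ^ 2 * ε₁ + ε₁) * Δ + 2 * ε * Δ + 2 * ε * ε₁ * Δ + 2 * ε * ε₁ * Δ + 2 * ε * ε₁ * Δ ≤ 24 * (ε + ε₁) * Δ := by
  have h1 : ε ^ 2 ≤ ε / 2 := by nlinarith only [hε, hε']
  have h2 : ε₁ ^ 2 ≤ ε₁ / 2 := by nlinarith only [hε₁, hε₁']
  have h3 : ε * ε₁ ≤ ε₁ / 2 := by nlinarith only [hε, hε', hε₁]
  have h4 : ε ^ 2 * ε₁ ≤ ε₁ / 4 := by nlinarith only [h1, hε, hε', hε₁]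
  have key : (3 * ε ^ 2 + ε₁ ^ 2) + (3 * ε ^ 2 + ε₁ ^ 2) + 4 * ε * ε₁ + (2 * ε ^ 2 * ε₁ + ε₁)
      + (2 * ε ^ 2 * ε₁ + ε₁) + 2 * ε + 2 * ε * ε₁ + 2 * ε * ε₁ + 2 * ε * ε₁ ≤ 24 * (ε + ε₁) := by
    linarith only [h1, h2, h3, h4, hε, hε₁]
  have := mul_le_mul_of_nonneg_right key hΔ
  linarith only [this]

end TermBounds

/-- The term-wise Lipschitz estimate behind Lemma (r-lemma-two): for `|U⃗ᵢ|, |Z⃗ᵢ| ≤ ε`, `|V⃗| ≤ ε₁`, `V⁰ ∈ [0,1]`, `u₁, u₂, z₂ ∈ [0,1]`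
with `|u₁ − u₂| ≤ 2ε|U⃗₁ − U⃗₂|`, `|z₁ − z₂| ≤ 2ε|Z⃗₁ − Z⃗₂|` ((second-delta-estimate)), `1 − u₂V⁰, 1 − z₂V⁰ ≤ ε² + ε₁²`
((first-delta-estimate)) and `|U⃗₁ − U⃗₂|, |Z⃗₁ − Z⃗₂| ≤ Δ`: the nine-term expressions differ by at most `24(ε + ε₁)Δ`.
[cite: DybalskiStottmeisterTanimoto2024, §4.6 proof of Lemma (r-lemma-two) (items `r⃗₁,…,r⃗₉`)] -/
theorem norm_nineTerms_sub_le {ε ε₁ Δ : ℝ} (hε : 0 ≤ ε) (hε' : ε ≤ 1 / 2) (hε₁ : 0 ≤ ε₁) (hε₁' : ε₁ ≤ 1 / 2) (hΔ : 0 ≤ Δ)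
    {V U₁ U₂ Z₁ Z₂ : su2} {v0 u₁ u₂ z₁ z₂ : ℝ}
    (hV : ‖V‖ ≤ ε₁) (hv0 : 0 ≤ v0) (hv1 : v0 ≤ 1)
    (hU₁ : ‖U₁‖ ≤ ε) (hU₂ : ‖U₂‖ ≤ ε) (hZ₁ : ‖Z₁‖ ≤ ε) (hZ₂ : ‖Z₂‖ ≤ ε)
    (hu₁ : 0 ≤ u₁) (hu₁' : u₁ ≤ 1) (hu₂ : 0 ≤ u₂) (hu₂' : u₂ ≤ 1) (hz₂ : 0 ≤ z₂) (hz₂' : z₂ ≤ 1)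
    (hdu : |u₁ - u₂| ≤ 2 * ε * ‖U₁ - U₂‖) (hdz : |z₁ - z₂| ≤ 2 * ε * ‖Z₁ - Z₂‖)
    (hδu : 1 - u₂ * v0 ≤ ε ^ 2 + ε₁ ^ 2) (hδz : 1 - z₂ * v0 ≤ ε ^ 2 + ε₁ ^ 2)
    (hΔU : ‖U₁ - U₂‖ ≤ Δ) (hΔZ : ‖Z₁ - Z₂‖ ≤ Δ) :
    ‖nineTerms V v0 U₁ Z₁ u₁ z₁ - nineTerms V v0 U₂ Z₂ u₂ z₂‖ ≤ 24 * (ε + ε₁) * Δ := by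
  have hdu' : |u₁ - u₂| ≤ 2 * ε * Δ := hdu.trans (mul_le_mul_of_nonneg_left hΔU (by positivity))
  have hdz' : |z₁ - z₂| ≤ 2 * ε * Δ := hdz.trans (mul_le_mul_of_nonneg_left hΔZ (by positivity))
  have hδu0 : 0 ≤ 1 - u₂ * v0 := by nlinarith only [hu₂, hu₂', hv0, hv1]
  have hδz0 : 0 ≤ 1 - z₂ * v0 := by nlinarith only [hz₂, hz₂', hv0, hv1]
  have t1 := lip_term1 (ε₁ := ε₁) hε hΔ hv0 hv1 hZ₁ hdu' hδu0 hδu hΔZ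
  have t2 := lip_term1 (ε₁ := ε₁) hε hΔ hv0 hv1 hU₁ hdz' hδz0 hδz hΔU
  have t3 := lip_term3 hε hΔ hV hu₁ hu₁' hz₂ hz₂' hdu' hdz'
  have t4 := lip_term4 hε hΔ hV hU₁ hz₂ hz₂' hdz' hΔU
  have t5 := lip_term5 hε hΔ hV hZ₁ hu₂ hu₂' hdu' hΔZ
  have t6 := lip_term6 hε hΔ hv0 hv1 hZ₁ hU₂ hΔU hΔZ
  have t7 := lip_term7 hε hΔ hV hU₂ hZ₁ hΔU hΔZ
  have t8 := lip_term7 hε hΔ hV hZ₂ hU₁ hΔZ hΔU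
  have t9 := lip_term9 hε hΔ hV hU₁ hZ₂ hΔU hΔZ
  have e : nineTerms V v0 U₁ Z₁ u₁ z₁ - nineTerms V v0 U₂ Z₂ u₂ z₂ =
      ((1 - u₁ * v0) • Z₁ - (1 - u₂ * v0) • Z₂) - ((1 - z₁ * v0) • U₁ - (1 - z₂ * v0) • U₂)
      + ((z₁ * u₁) • V - (z₂ * u₂) • V) - (z₁ • crossLin U₁ V - z₂ • crossLin U₂ V)
      + (u₁ • crossLin V Z₁ - u₂ • crossLin V Z₂) + (v0 • crossLin U₁ Z₁ - v0 • crossLin U₂ Z₂)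
      + (⟪U₁, V⟫ • Z₁ - ⟪U₂, V⟫ • Z₂) + (⟪Z₁, V⟫ • U₁ - ⟪Z₂, V⟫ • U₂) - (⟪Z₁, U₁⟫ • V - ⟪Z₂, U₂⟫ • V) := by
    unfold nineTerms; abel
  rw [e]
  have hsum := norm_sub_le_of_le (norm_add_le_of_le (norm_add_le_of_le (norm_add_le_of_le (norm_add_le_of_le
    (norm_sub_le_of_le (norm_add_le_of_le (norm_sub_le_of_le t1 t2) t3) t4) t5) t6) t7) t8) t9
  exact hsum.trans (lip_tally hε hε' hε₁ hε₁' hΔ)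

/-- **Lemma (r-lemma-two)**, per bond: for `U′ᵢ = [A⃗ᵢ]`, `|A⃗ᵢ(x)| ≤ ε`, `|V⃗(b)| ≤ ε₁` with `V⁰ ≥ 0` (`δ_V = 1`), `0 ≤ ε, ε₁ ≤ 1/2`
and `‖A⃗₁ − A⃗₂‖_{∞;Ω} ≤ Δ`: `|r⃗_{A⃗₁}(b) − r⃗_{A⃗₂}(b)| ≤ 24(ε + ε₁)Δ`.
[cite: DybalskiStottmeisterTanimoto2024, §4.6 Lemma (r-lemma-two), proof] -/
theorem norm_rvec_sub_le {ε ε₁ Δ : ℝ} (hε : 0 ≤ ε) (hε' : ε ≤ 1 / 2) (hε₁ : 0 ≤ ε₁) (hε₁' : ε₁ ≤ 1 / 2)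
    (A₁ A₂ : Site L n₁ → su2) (h₁ : ∀ x, ‖A₁ x‖ ≤ ε) (h₂ : ∀ x, ‖A₂ x‖ ≤ ε) {V : CConf n₁}
    (hV : ∀ b : Bond L n₁, ‖vecOf (pdV V b)‖ ≤ ε₁) (hV0 : ∀ b : Bond L n₁, 0 ≤ (pdV V b).re)
    (hΔ : ∀ x, ‖A₁ x - A₂ x‖ ≤ Δ) (b : Bond L n₁) :
    ‖rvec (brkConf A₁) V b - rvec (brkConf A₂) V b‖ ≤ 24 * (ε + ε₁) * Δ := by
  have h₁' : ∀ x, ‖A₁ x‖ ≤ 1 := fun x => (h₁ x).trans (by linarith)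
  have h₂' : ∀ x, ‖A₂ x‖ ≤ 1 := fun x => (h₂ x).trans (by linarith)
  rw [rvec_brkConf A₁ h₁' V b, rvec_brkConf A₂ h₂' V b]
  have hΔ0 : 0 ≤ Δ := (norm_nonneg _).trans (hΔ b.src)
  have hv1 : (pdV V b).re ≤ 1 := by
    have := abs_re_le_one (V (blk b.src) * (V (blk b.tgt))⁻¹)
    rw [← pdV_eq_val] at this
    exact (le_abs_self _).trans this
  -- (first-delta-estimate) for `[A⃗₂]` at both ends
  have hδ : ∀ x, 1 - A0 (A₂ x) * (pdV V b).re ≤ ε ^ 2 + ε₁ ^ 2 := fun x => by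
    have hd := delta_le (brk (A₂ x)) (V (blk b.src) * (V (blk b.tgt))⁻¹)
      (by rw [re_brk _ (h₂' x)]; exact A0_nonneg _) (by rw [← pdV_eq_val]; exact hV0 b)
    rw [re_brk _ (h₂' x), vecOf_brk _ (h₂' x), ← pdV_eq_val] at hd
    have e1 : ‖A₂ x‖ ^ 2 ≤ ε ^ 2 := pow_le_pow_left₀ (norm_nonneg _) (h₂ x) 2
    have e2 : ‖vecOf (pdV V b)‖ ^ 2 ≤ ε₁ ^ 2 := pow_le_pow_left₀ (norm_nonneg _) (hV b) 2
    linarith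
  exact norm_nineTerms_sub_le hε hε' hε₁ hε₁' hΔ0 (hV b) (hV0 b) hv1 (h₁ b.src) (h₂ b.src) (h₁ b.tgt) (h₂ b.tgt)
    (A0_nonneg _) (A0_le_one _) (A0_nonneg _) (A0_le_one _) (A0_nonneg _) (A0_le_one _)
    (abs_A0_sub_A0_le hε' _ _ (h₁ b.src) (h₂ b.src)) (abs_A0_sub_A0_le hε' _ _ (h₁ b.tgt) (h₂ b.tgt))
    (hδ b.src) (hδ b.tgt) (hΔ b.src) (hΔ b.tgt)

/-- `∂*(g₁) − ∂*(g₂) = ∂*(g₁ − g₂)`. [cite: DybalskiStottmeisterTanimoto2024, §3.3 (adjoint)] -/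
theorem delStar_sub {M : Type*} [AddCommGroup M] (g g' : Bond L n₁ → M) : delStar g - delStar g' = delStar (g - g') := by
  rw [sub_eq_add_neg, ← delStar_neg, ← delStar_add, ← sub_eq_add_neg]

/-- **Lemma (r-lemma-two).** «Suppose that `|V⃗(b)| ≤ ε₁`, `A⃗₁, A⃗₂ ∈ Conf⃗^ε(Ω)`, `s₁ = s₂ = 1`, `0 < ε₁, ε ≤ 1/2`.  Then
`‖∂*r⃗_{A⃗₁} − ∂*r⃗_{A⃗₂}‖_{∞;Ω} ≤ 96(ε + ε₁)‖A⃗₁ − A⃗₂‖_{∞;Ω}`.» (Here with `‖A⃗₁ − A⃗₂‖_{∞;Ω} ≤ Δ` and `δ_V = 1` as `hV0`.)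
[cite: DybalskiStottmeisterTanimoto2024, §4.6 Lemma (r-lemma-two)] -/
theorem r_lemma_two {ε ε₁ Δ : ℝ} (hε : 0 ≤ ε) (hε' : ε ≤ 1 / 2) (hε₁ : 0 ≤ ε₁) (hε₁' : ε₁ ≤ 1 / 2)
    (A₁ A₂ : Site L n₁ → su2) (h₁ : ∀ x, ‖A₁ x‖ ≤ ε) (h₂ : ∀ x, ‖A₂ x‖ ≤ ε) {V : CConf n₁}
    (hV : ∀ b : Bond L n₁, ‖vecOf (pdV V b)‖ ≤ ε₁) (hV0 : ∀ b : Bond L n₁, 0 ≤ (pdV V b).re)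
    (hΔ : ∀ x, ‖A₁ x - A₂ x‖ ≤ Δ) (x : Site L n₁) :
    ‖delStar (rvec (brkConf A₁) V) x - delStar (rvec (brkConf A₂) V) x‖ ≤ 96 * (ε + ε₁) * Δ := by
  have hΔ0 : 0 ≤ Δ := (norm_nonneg _).trans (hΔ x)
  rw [← Pi.sub_apply, delStar_sub]
  have h := norm_delStar_le_four_mul (rvec (brkConf A₁) V - rvec (brkConf A₂) V) (M := 24 * (ε + ε₁) * Δ)
    (by positivity) (fun b => norm_rvec_sub_le hε hε' hε₁ hε₁' A₁ A₂ h₁ h₂ hV hV0 hΔ b) x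
  linarith

end

end Literature.MathematicalPhysics.QuantumFieldTheory.DybalskiStottmeisterTanimoto2024.DST24RemainderLipschitz
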